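import Literature.IUT.HodgeTheaters.InitialThetaDataTorsionCuspModelCuspGalois
import Literature.IUT.HodgeTheaters.PuncturedEllipticCoveringsBasic
import HarnessLib

/-!
# [IUTchI] §1 p.37–38 at the group-ring two-step model: the `Δ`-side of `pedOf₃` and the two bounds on
# `Ker(Δ_X̲ ↠ Δ_X̲^{ab} ⊗ ℤ/l)` (NV-L5 row «JOINT-NV-CG (l cusps)», part B5a)

S. Mochizuki, *Inter-universal Teichmüller theory I*, kurims manuscript (May 2020), §1 p. 37 l. 30 – p. 38 l. 24:
«`Δ_X̲ ↠ Δ_X̲^{ab} ⊗ (ℤ/lℤ) ↠ Δ_ε` … a natural exact sequence `0 → I_{ε′} × I_{ε″} → Δ_ε → Δ_E ⊗ (ℤ/lℤ) → 0` … `ι`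
acts on `Δ_E ⊗ (ℤ/lℤ)` via multiplication by `−1`» — the six LAWS `PuncturedEllipticData.ModLCuspLaws` of
abc-iut-L5-t1 (`PuncturedEllipticCoveringsModLCuspLaws.lean`, p446054) quote these sentences.  [claim: Mochizuki2012,
status: disputed] (D-0012 claim key; series status DISPUTED — a MODEL of the cell's `π₁`-interface structures; nothing
of the series is asserted; no side taken on [IUTchIII] Cor. 3.12).

## WHAT (parts B1–B4 landed: p454544, p455671, p456777, p459626; design memo HOME/staging/L5/L5-t8/g7/STEP0-jointNV-CG.md)

The INFRASTRUCTURE for proving the laws at `pedOf₃ G g s h a …` (part B5b), where `Δ_C = 1 × DihU`,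
`Δ_X̲ = 1 × ((U ⋊ ℤ·g) ⋊ 1)` is a finite TWO-STEP group (`U = 𝔽_l[E_F[l]]`):
* `embU : U ↪ G × DihU` (the `U`-part of `Δ_X̲`); membership descriptions `mem_deltaC₃`, `mem_deltaXbar₃`,
  `mem_deltaCbar₃`, `mem_inertia₃` of t1's `Δ_C`, `Δ_X̲`, `Δ_C̲`, `I_x` at `pedOf₃`;
* the COBOUNDARY subgroup `cob g = I_{ℤ·g} · U ⊆ U` generated by `τ_t f · f⁻¹` (`t ∈ ℤ·g`) and the LOWER BOUND
  **`map_embU_cob_le_modLKer₃`**: `1 × cob g ⊆ Ker(Δ_X̲ ↠ Δ_X̲^{ab} ⊗ ℤ/l)` (each generator IS a commutator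
  `[(1, (0, t)), (1, (f, 1))]`); hence (L4) **`inertia_central₃`** (`Π_X̲` centralises every `I_x` modulo the kernel);
* the COSET FUNCTIONAL `Λ_b(w) = Σ_{k ∈ ℤ·g} w(b k)` (`cosetSum`, `lam`), `τ_t`-invariant for `t ∈ ℤ·g`, with
  `Λ_b(e_P) = [b⁻¹P ∈ ℤ·g]` and **`lam_ivec`**: `Λ_h(ivec_x) = [x = ε⁰] − [x = ε′]`; the homomorphism
  `lamW : (U ⋊ ℤ·g) ⋊ 1 → 𝔽_l`, `d ↦ Λ_h(d_U)`, its kernel `lamKer`, and the UPPER BOUNDS **`modLKer_le_lamKer₃`**,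
  **`deltaEpsKer_le_lamKer₃`**: `Ker(Δ_X̲ ↠ Δ_ε) ⊆ 1 × lamKer` (commutators and `l`-th powers die under the
  homomorphism `lamW`; the inertia of the cusps `≠ ε⁰, ε′` dies under `Λ_h`) — while `Λ_h(igen_{ε′}) = −1`.

HONEST LABEL «[model; `E[l]`-twisted finite shadow `U ⋊ E[l]`; `l` cusps]»; no law is claimed in this file (part B5b).
Model ≠ genuine datum; typed ≠ proved; no side taken on [IUTchIII] Cor. 3.12.
-/

noncomputable section

namespace Literature.IUT.HodgeTheaters

universe u

namespace TorsionCuspModel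
open Literature.AnabelianGeometry.AbsoluteAnabelian Topology TorsionMonodromyModel
open Literature.AnabelianGeometry.EtaleTheta.SettingModel
open scoped WeierstrassCurve.Affine Classical Pointwise

variable {F : Type u} [Field F] {E : WeierstrassCurve F} {Fbar : Type u} [Field Fbar] [Algebra F Fbar] {l : ℕ}

/-! ## `U`-level: exponent `l`, the embedding `embU`, the coboundary subgroup -/

/-- `U = 𝔽_l[E_F[l]]` has exponent `l`. [cite: Mochizuki2012, IUTchI §1 p.37] -/
theorem U.pow_l [NeZero l] (w : U E Fbar l) : w ^ l = 1 :=
  U.ext fun Q => by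
    rw [toAdd_pow, Pi.smul_apply, U.toAdd_one_apply, nsmul_eq_mul, ZMod.natCast_self, zero_mul]

/-- `w ^ n = 1` when `l ∣ n`. [cite: Mochizuki2012, IUTchI §1 p.37] -/
theorem U.zpow_eq_one_of_cast_eq_zero (w : U E Fbar l) {n : ℤ} (hn : (n : ZMod l) = 0) : w ^ n = 1 :=
  U.ext fun Q => by rw [toAdd_zpow, Pi.smul_apply, U.toAdd_one_apply, zsmul_eq_mul, hn, zero_mul]

/-- The embedding `U ↪ G × DihU`, `w ↦ (1, ((w, 1), 1))`: the `U`-part of `Δ_X̲ = 1 × ((U ⋊ ℤ·g) ⋊ 1)`.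
[cite: Mochizuki2012, IUTchI §1 p.37] -/
def embU (G : Type u) [Group G] : U E Fbar l →* G × DihU F E Fbar l :=
  (MonoidHom.inr G (DihU F E Fbar l)).comp (SemidirectProduct.inl.comp SemidirectProduct.inl)

/-- [cite: Mochizuki2012, IUTchI §1 p.37] -/
@[simp] theorem embU_fst (G : Type u) [Group G] (w : U E Fbar l) : (embU (F := F) G w).1 = 1 := rfl

/-- [cite: Mochizuki2012, IUTchI §1 p.37] -/
@[simp] theorem embU_snd (G : Type u) [Group G] (w : U E Fbar l) :
    (embU (F := F) G w).2 = SemidirectProduct.inl (SemidirectProduct.inl w) := rfl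

/-- The COBOUNDARY subgroup `I_{ℤ·g} · U ⊆ U = 𝔽_l[E_F[l]]`: generated by `τ_t f · f⁻¹`, `t ∈ ℤ·g` (the image of the
augmentation ideal of `𝔽_l[ℤ·g]` acting by translation). [cite: Mochizuki2012, IUTchI §1 p.37] -/
def cob (g : Tors E Fbar l) : Subgroup (U E Fbar l) :=
  Subgroup.closure {w | ∃ t ∈ Subgroup.zpowers g, ∃ f : U E Fbar l, w = transl E Fbar l t f * f⁻¹}

/-- [cite: Mochizuki2012, IUTchI §1 p.37] -/
theorem transl_mul_inv_mem_cob {g t : Tors E Fbar l} (ht : t ∈ Subgroup.zpowers g) (f : U E Fbar l) :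
    transl E Fbar l t f * f⁻¹ ∈ cob g :=
  Subgroup.subset_closure ⟨t, ht, f, rfl⟩

/-- `e_{P t} · e_P⁻¹ ∈ I_{ℤ·g} · U` for `t ∈ ℤ·g`. [cite: Mochizuki2012, IUTchI §1 p.37] -/
theorem e_mul_inv_e_mem_cob {g t : Tors E Fbar l} (ht : t ∈ Subgroup.zpowers g) (P : Tors E Fbar l) :
    U.e (P * t) * (U.e P)⁻¹ ∈ cob (E := E) (Fbar := Fbar) g := by
  rw [← transl_e]; exact transl_mul_inv_mem_cob ht _

/-! ## The coset functional `Λ_b(w) = Σ_{k ∈ ℤ·g} w(b k)` -/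

section Lam

variable [E.IsElliptic] [NeZero l]

/-- The finite set `ℤ·g ⊆ E_F[l](F̄)`. [cite: Mochizuki2012, IUTchI §1 p.37] -/
def lineFinset (g : Tors E Fbar l) : Finset (Tors E Fbar l) :=
  (Set.toFinite (Subgroup.zpowers g : Set (Tors E Fbar l))).toFinset

/-- [cite: Mochizuki2012, IUTchI §1 p.37] -/
theorem mem_lineFinset {g k : Tors E Fbar l} : k ∈ lineFinset g ↔ k ∈ Subgroup.zpowers g := by
  rw [lineFinset, Set.Finite.mem_toFinset, SetLike.mem_coe]

/-- **The coset functional** `Λ_b : (E_F[l] → 𝔽_l) →+ 𝔽_l`, `w ↦ Σ_{k ∈ ℤ·g} w(b·k)` (the sum of the coordinates over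
the coset `b·ℤ·g`; it factors through the `ℤ·g`-coinvariants of `U`). [cite: Mochizuki2012, IUTchI §1 p.37] -/
def cosetSum (g b : Tors E Fbar l) : (Tors E Fbar l → ZMod l) →+ ZMod l :=
  ∑ k ∈ lineFinset g, Pi.evalAddMonoidHom (fun _ => ZMod l) (b * k)

/-- [cite: Mochizuki2012, IUTchI §1 p.37] -/
theorem cosetSum_apply (g b : Tors E Fbar l) (w : Tors E Fbar l → ZMod l) :
    cosetSum g b w = ∑ k ∈ lineFinset g, w (b * k) := by
  rw [cosetSum, AddMonoidHom.finsetSum_apply]; rfl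

/-- `Λ_b` as a multiplicative character of `U`. [cite: Mochizuki2012, IUTchI §1 p.37] -/
def lam (g b : Tors E Fbar l) : U E Fbar l →* Multiplicative (ZMod l) :=
  AddMonoidHom.toMultiplicative (cosetSum g b)

/-- [cite: Mochizuki2012, IUTchI §1 p.37] -/
theorem lam_apply (g b : Tors E Fbar l) (w : U E Fbar l) :
    lam g b w = Multiplicative.ofAdd (cosetSum g b (Multiplicative.toAdd w)) := rfl

/-- **`ℤ·g`-invariance**: `Λ_b(τ_t w) = Λ_b(w)` for `t ∈ ℤ·g` (reindex the coset). [cite: Mochizuki2012, IUTchI §1 p.37] -/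
theorem lam_transl {g b t : Tors E Fbar l} (ht : t ∈ Subgroup.zpowers g) (w : U E Fbar l) :
    lam g b (transl E Fbar l t w) = lam g b w := by
  rw [lam_apply, lam_apply, cosetSum_apply, cosetSum_apply]
  congr 1
  refine Finset.sum_nbij' (· * t⁻¹) (· * t) (fun k hk => ?_) (fun k hk => ?_) (fun k _ => by simp) (fun k _ => by simp)
    (fun k _ => by rw [toAdd_transl_apply, mul_assoc])
  · exact mem_lineFinset.mpr (Subgroup.mul_mem _ (mem_lineFinset.mp hk) (Subgroup.inv_mem _ ht))
  · exact mem_lineFinset.mpr (Subgroup.mul_mem _ (mem_lineFinset.mp hk) ht)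

/-- `Λ_b(e_P) = [b⁻¹ P ∈ ℤ·g]`. [cite: Mochizuki2012, IUTchI §1 p.37] -/
theorem cosetSum_e (g b P : Tors E Fbar l) :
    cosetSum g b (Multiplicative.toAdd (U.e P)) = if b⁻¹ * P ∈ Subgroup.zpowers g then 1 else 0 := by
  rw [cosetSum_apply]
  simp_rw [U.toAdd_e_apply, ← eq_inv_mul_iff_mul_eq]
  rw [Finset.sum_ite_eq']
  exact if_congr mem_lineFinset rfl rfl

/-- `Λ_b(e_P · e_Q⁻¹) = [b⁻¹P ∈ ℤ·g] − [b⁻¹Q ∈ ℤ·g]`. [cite: Mochizuki2012, IUTchI §1 p.37] -/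
theorem lam_e_mul_inv_e (g b P Q : Tors E Fbar l) : lam g b (U.e P * (U.e Q)⁻¹) =
    Multiplicative.ofAdd ((if b⁻¹ * P ∈ Subgroup.zpowers g then 1 else 0) -
      (if b⁻¹ * Q ∈ Subgroup.zpowers g then (1 : ZMod l) else 0)) := by
  rw [lam_apply, toAdd_mul, toAdd_inv, map_add, map_neg, cosetSum_e, cosetSum_e, sub_eq_add_neg]

/-- **`Λ_h(ivec_x) = [x = ε⁰] − [x = ε′]`** for a section `s` and `h² = a` (`ε⁰ = [1]`, `ε′ = [a]`): the coset functional
at `h` kills the inertia vectors of all cusps `≠ ε⁰, ε′` and is `−1` on `ivec_{ε′}`. [cite: Mochizuki2012, IUTchI §1 p.37] -/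
theorem lam_ivec {g : Tors E Fbar l} (s : Tors E Fbar l ⧸ Subgroup.zpowers g → Tors E Fbar l) {h a : Tors E Fbar l}
    (hs : ∀ q : Tors E Fbar l ⧸ Subgroup.zpowers g, (QuotientGroup.mk (s q) : _ ⧸ Subgroup.zpowers g) = q)
    (hh : h ^ 2 = a) (x : Tors E Fbar l ⧸ Subgroup.zpowers g) :
    lam g h (ivec s h x) = Multiplicative.ofAdd ((if x = 1 then 1 else 0) -
      (if x = QuotientGroup.mk a then (1 : ZMod l) else 0)) := by
  rw [ivec, lam_e_mul_inv_e]
  have e1 : h⁻¹ * (s x * h) = s x := by rw [mul_comm (s x) h, inv_mul_cancel_left]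
  have e2 : h⁻¹ * (s x * h⁻¹) = s x * a⁻¹ := by
    rw [mul_comm (s x) h⁻¹, ← mul_assoc, ← mul_inv, ← pow_two, hh, mul_comm]
  have i1 : (s x ∈ Subgroup.zpowers g ↔ x = 1) := by rw [← QuotientGroup.eq_one_iff, hs]
  have i2 : (s x * a⁻¹ ∈ Subgroup.zpowers g ↔ x = QuotientGroup.mk a) := by
    rw [← QuotientGroup.eq_one_iff, QuotientGroup.mk_mul, QuotientGroup.mk_inv, hs, mul_inv_eq_one]
  simp only [e1, e2, i1, i2]

end Lam

/-! ## The `Δ`-side of the `K`-level datum `pedOf₃` -/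

section DeltaSide

variable (G : Type u) [Group G] [TopologicalSpace G] [IsTopologicalGroup G] [CompactSpace G]
  [TotallyDisconnectedSpace G] [E.IsElliptic] [NeZero l]
  {g : Tors E Fbar l} (s : Tors E Fbar l ⧸ Subgroup.zpowers g → Tors E Fbar l) (h a : Tors E Fbar l)
  (hl : l.Prime) (ha : a ∉ Subgroup.zpowers g) (h5 : 5 ≤ l) (h6 : l.Coprime 6)

/-- `Δ_C = 1 × DihU`. [cite: Mochizuki2012, IUTchI §1 p.37] -/
theorem mem_deltaC₃ {x : (pedOf₃ F E Fbar l G g s h a hl ha h5 h6).PiC} :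
    x ∈ (pedOf₃ F E Fbar l G g s h a hl ha h5 h6).DeltaC ↔ x.1 = 1 := Iff.rfl

/-- `Δ_X̲ = 1 × ((U ⋊ ℤ·g) ⋊ 1)`. [cite: Mochizuki2012, IUTchI §1 p.37] -/
theorem mem_deltaXbar₃ {x : (pedOf₃ F E Fbar l G g s h a hl ha h5 h6).PiC} :
    x ∈ (pedOf₃ F E Fbar l G g s h a hl ha h5 h6).DeltaXbar ↔
      x.1 = 1 ∧ x.2.right = 1 ∧ x.2.left.right ∈ Subgroup.zpowers g := by
  show (x.2 ∈ dX F E Fbar l ∧ x.2 ∈ dC F E g) ∧ x.1 = 1 ↔ _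
  rw [mem_dX_iff, mem_dC_iff]; tauto

/-- `Δ_C̲ = 1 × ((U ⋊ ℤ·g) ⋊ {±1})`. [cite: Mochizuki2012, IUTchI §1 p.37] -/
theorem mem_deltaCbar₃ {x : (pedOf₃ F E Fbar l G g s h a hl ha h5 h6).PiC} :
    x ∈ (pedOf₃ F E Fbar l G g s h a hl ha h5 h6).DeltaCbar ↔ x.1 = 1 ∧ x.2.left.right ∈ Subgroup.zpowers g := by
  show x.2 ∈ dC F E g ∧ x.1 = 1 ↔ _
  rw [mem_dC_iff]; tauto

/-- `I_x = 1 × ⟨igen_x⟩`. [cite: Mochizuki2012, IUTchI §1 p.37] -/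
theorem mem_inertia₃ {x : (pedOf₃ F E Fbar l G g s h a hl ha h5 h6).PiC} {q : Tors E Fbar l ⧸ Subgroup.zpowers g} :
    x ∈ (pedOf₃ F E Fbar l G g s h a hl ha h5 h6).inertia q ↔
      x.1 = 1 ∧ x.2 ∈ Subgroup.zpowers (igen (F := F) s h q) := by
  show x.2 ∈ Subgroup.zpowers (igen (F := F) s h q) ∧ x.1 = 1 ↔ _
  tauto

/-- Elements of `I_x` are `(1, igen_x ^ n) = (1, (ivec_x ^ n, 1, 1))`. [cite: Mochizuki2012, IUTchI §1 p.37] -/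
theorem eq_embU_of_mem_inertia₃ {x : (pedOf₃ F E Fbar l G g s h a hl ha h5 h6).PiC}
    {q : Tors E Fbar l ⧸ Subgroup.zpowers g} (hx : x ∈ (pedOf₃ F E Fbar l G g s h a hl ha h5 h6).inertia q) :
    ∃ n : ℤ, x = embU G (ivec s h q ^ n) := by
  obtain ⟨hx1, hx2⟩ := (mem_inertia₃ G s h a hl ha h5 h6).mp hx
  obtain ⟨n, hn⟩ := Subgroup.mem_zpowers_iff.mp hx2
  refine ⟨n, Prod.ext hx1 ?_⟩
  rw [embU_snd, map_zpow, map_zpow, ← hn, igen]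

/-- `Δ_X̲` is finite (a copy of the finite group `(U ⋊ ℤ·g) ⋊ 1`). [cite: Mochizuki2012, IUTchI §1 p.37] -/
theorem finite_deltaXbar₃ : Finite ↥(pedOf₃ F E Fbar l G g s h a hl ha h5 h6).DeltaXbar := by
  refine Finite.of_injective (fun x => ((x : (pedOf₃ F E Fbar l G g s h a hl ha h5 h6).PiC)).2) fun x y hxy => ?_
  have hx := ((mem_deltaXbar₃ G s h a hl ha h5 h6).mp x.2).1
  have hy := ((mem_deltaXbar₃ G s h a hl ha h5 h6).mp y.2).1
  exact Subtype.ext (Prod.ext (hx.trans hy.symm) hxy)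

/-! ### LOWER bound: coboundaries are commutators -/

omit [TopologicalSpace G] [IsTopologicalGroup G] [CompactSpace G] [TotallyDisconnectedSpace G] [E.IsElliptic]
  [NeZero l] in
/-- `(1, (0, t)) · embU f · (1, (0, t))⁻¹ · (embU f)⁻¹ = embU (τ_t f · f⁻¹)`. [cite: Mochizuki2012, IUTchI §1 p.37] -/
theorem commutator_inr_embU (t : Tors E Fbar l) (f : U E Fbar l) :
    ((1 : G), (SemidirectProduct.inl (SemidirectProduct.inr t) : DihU F E Fbar l)) * embU G f *
        ((1 : G), (SemidirectProduct.inl (SemidirectProduct.inr t) : DihU F E Fbar l))⁻¹ * (embU G f)⁻¹ =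
      embU (F := F) G (transl E Fbar l t f * f⁻¹) := by
  refine Prod.ext (by simp) ?_
  show SemidirectProduct.inl (SemidirectProduct.inr t) * SemidirectProduct.inl (SemidirectProduct.inl f) *
      (SemidirectProduct.inl (SemidirectProduct.inr t))⁻¹ * (SemidirectProduct.inl (SemidirectProduct.inl f))⁻¹ =
    SemidirectProduct.inl (SemidirectProduct.inl (transl E Fbar l t f * f⁻¹))
  rw [conj_inl_inl, SemidirectProduct.left_inl, SemidirectProduct.right_inr, SemidirectProduct.right_inl,
    Prod.mk_one_one, outU_one, MulAut.one_apply, map_mul, map_mul, map_inv, map_inv]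

/-- **LOWER BOUND**: `1 × (I_{ℤ·g}·U) ⊆ Ker(Δ_X̲ ↠ Δ_X̲^{ab} ⊗ ℤ/l)` — every generator `τ_t f · f⁻¹` is the commutator
of `(1, (0, t))` and `(1, (f, 1))`, both in `Δ_X̲`. [cite: Mochizuki2012, IUTchI §1 p.37] -/
theorem map_embU_cob_le_modLKer₃ :
    (cob g).map (embU G) ≤ (pedOf₃ F E Fbar l G g s h a hl ha h5 h6).modLKer := by
  rw [Subgroup.map_le_iff_le_comap, cob, Subgroup.closure_le]
  rintro _ ⟨t, ht, f, rfl⟩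
  rw [SetLike.mem_coe, Subgroup.mem_comap]
  obtain ⟨A, hAdef⟩ : ∃ A : (pedOf₃ F E Fbar l G g s h a hl ha h5 h6).PiC,
      A = ((1 : G), (SemidirectProduct.inl (SemidirectProduct.inr t) : DihU F E Fbar l)) := ⟨_, rfl⟩
  obtain ⟨B, hBdef⟩ : ∃ B : (pedOf₃ F E Fbar l G g s h a hl ha h5 h6).PiC, B = embU G f := ⟨_, rfl⟩
  have hA : A ∈ (pedOf₃ F E Fbar l G g s h a hl ha h5 h6).DeltaXbar := by
    rw [hAdef]; exact (mem_deltaXbar₃ G s h a hl ha h5 h6).mpr ⟨rfl, rfl, ht⟩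
  have hB : B ∈ (pedOf₃ F E Fbar l G g s h a hl ha h5 h6).DeltaXbar := by
    rw [hBdef]; exact (mem_deltaXbar₃ G s h a hl ha h5 h6).mpr ⟨rfl, rfl, one_mem _⟩
  have hmem : A * B * A⁻¹ * B⁻¹ ∈ (pedOf₃ F E Fbar l G g s h a hl ha h5 h6).modLKer := by
    rw [← commutatorElement_def]
    exact Subgroup.le_topologicalClosure (G := (pedOf₃ F E Fbar l G g s h a hl ha h5 h6).PiC) _
      (Subgroup.mem_sup_left (Subgroup.commutator_mem_commutator hA hB))
  have e2 : A * B * A⁻¹ * B⁻¹ = embU G (transl E Fbar l t f * f⁻¹) := by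
    rw [hAdef, hBdef]; exact commutator_inr_embU G t f
  exact e2 ▸ hmem

/-- `embU (τ_t f · f⁻¹) ∈ Ker(Δ_X̲ ↠ Δ_X̲^{ab} ⊗ ℤ/l)` for `t ∈ ℤ·g`. [cite: Mochizuki2012, IUTchI §1 p.37] -/
theorem embU_mem_modLKer₃_of_mem_cob {w : U E Fbar l} (hw : w ∈ cob g) :
    embU G w ∈ (pedOf₃ F E Fbar l G g s h a hl ha h5 h6).modLKer :=
  map_embU_cob_le_modLKer₃ G s h a hl ha h5 h6 ⟨w, hw, rfl⟩

/-- **(L4) at the model: `Π_X̲` centralises every cusp inertia group modulo `Ker(Δ_X̲ ↠ Δ_X̲^{ab} ⊗ ℤ/l)`**: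
`g · (1, igen_x^n) · g⁻¹ · (1, igen_x^n)⁻¹ = embU (τ_{t_g} v · v⁻¹)`, `v = ivec_x^n`, a coboundary.
[cite: Mochizuki2012, IUTchI §1 p.38] -/
theorem inertia_central₃ (q : Tors E Fbar l ⧸ Subgroup.zpowers g)
    (x : (pedOf₃ F E Fbar l G g s h a hl ha h5 h6).PiC) (hx : x ∈ (pedOf₃ F E Fbar l G g s h a hl ha h5 h6).PiXbar)
    (z : (pedOf₃ F E Fbar l G g s h a hl ha h5 h6).PiC) (hz : z ∈ (pedOf₃ F E Fbar l G g s h a hl ha h5 h6).inertia q) :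
    x * z * x⁻¹ * z⁻¹ ∈ (pedOf₃ F E Fbar l G g s h a hl ha h5 h6).modLKer := by
  obtain ⟨n, hn⟩ := eq_embU_of_mem_inertia₃ G s h a hl ha h5 h6 hz
  obtain ⟨hxr, hxt⟩ := (mem_dXbar_iff g x.2).mp ⟨mem_liftU.mp (Subgroup.mem_inf.mp hx).1,
    mem_liftU.mp (Subgroup.mem_inf.mp hx).2⟩
  have key : x * z * x⁻¹ * z⁻¹ =
      embU G (transl E Fbar l x.2.left.right (ivec s h q ^ n) * (ivec s h q ^ n)⁻¹) := by
    refine Prod.ext ?_ ?_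
    · change x.1 * z.1 * x.1⁻¹ * z.1⁻¹ = 1
      rw [hn, embU_fst, mul_one, inv_one, mul_one, mul_inv_cancel]
    · change x.2 * z.2 * x.2⁻¹ * z.2⁻¹ = SemidirectProduct.inl (SemidirectProduct.inl _)
      rw [hn, embU_snd, conj_inl_inl, hxr, Prod.mk_one_one, outU_one, MulAut.one_apply, map_mul, map_mul, map_inv,
        map_inv]
  rw [key]
  exact embU_mem_modLKer₃_of_mem_cob G s h a hl ha h5 h6 (transl_mul_inv_mem_cob hxt _)

/-! ### UPPER bound: the homomorphism `Λ_h ∘ (U-part)` on `(U ⋊ ℤ·g) ⋊ 1` -/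

/-- **`lamW : (U ⋊ ℤ·g) ⋊ 1 →* 𝔽_l`**, `d ↦ Λ_b(d_U)` — a HOMOMORPHISM because `Λ_b` is `τ_t`-invariant for `t ∈ ℤ·g`
(`(d₁ d₂)_U = d₁,_U · τ_{t₁} d₂,_U`). [cite: Mochizuki2012, IUTchI §1 p.37] -/
def lamW (g b : Tors E Fbar l) : ↥(dXbar F E g) →* Multiplicative (ZMod l) where
  toFun d := lam g b (d : DihU F E Fbar l).left.left
  map_one' := by
    show lam g b (1 : DihU F E Fbar l).left.left = 1
    rw [SemidirectProduct.one_left, SemidirectProduct.one_left, map_one]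
  map_mul' d₁ d₂ := by
    obtain ⟨h1r, h1t⟩ := (mem_dXbar_iff g _).mp d₁.2
    show lam g b ((d₁ : DihU F E Fbar l) * d₂).left.left = lam g b (d₁ : DihU F E Fbar l).left.left * lam g b (d₂ : DihU F E Fbar l).left.left
    rw [SemidirectProduct.mul_left, h1r, map_one, MulAut.one_apply, SemidirectProduct.mul_left, map_mul, lam_transl h1t]

/-- The kernel subgroup `lamKer ⊆ DihU`: elements of `(U ⋊ ℤ·g) ⋊ 1` whose `U`-part is killed by `Λ_b`.
[cite: Mochizuki2012, IUTchI §1 p.37] -/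
def lamKer (g b : Tors E Fbar l) : Subgroup (DihU F E Fbar l) := (lamW (F := F) g b).ker.map (dXbar F E g).subtype

/-- [cite: Mochizuki2012, IUTchI §1 p.37] -/
theorem mem_lamKer_iff {g b : Tors E Fbar l} {d : DihU F E Fbar l} :
    d ∈ lamKer g b ↔ ∃ _ : d ∈ dXbar F E g, lam g b d.left.left = 1 := by
  constructor
  · rintro ⟨d', hd', rfl⟩
    exact ⟨d'.2, hd'⟩
  · rintro ⟨hd, hlam⟩
    exact ⟨⟨d, hd⟩, hlam, rfl⟩

/-- **UPPER BOUND**: `Ker(Δ_X̲ ↠ Δ_X̲^{ab} ⊗ ℤ/l) ⊆ Δ_C ∩ (G × lamKer)` — commutators and `l`-th powers of `Δ_X̲` die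
under the homomorphism `lamW` (abelian target of exponent `l`), and the bound is closed. [cite: Mochizuki2012, IUTchI §1 p.37] -/
theorem modLKer_le_lamKer₃ (b : Tors E Fbar l) : (pedOf₃ F E Fbar l G g s h a hl ha h5 h6).modLKer ≤
    (pedOf₃ F E Fbar l G g s h a hl ha h5 h6).DeltaC ⊓ liftU G (lamKer g b) := by
  have hW : ∀ {x : (pedOf₃ F E Fbar l G g s h a hl ha h5 h6).PiC},
      x ∈ (pedOf₃ F E Fbar l G g s h a hl ha h5 h6).DeltaXbar → x.1 = 1 ∧ x.2 ∈ dXbar F E g := fun hx => by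
    obtain ⟨h1, hr, ht⟩ := (mem_deltaXbar₃ G s h a hl ha h5 h6).mp hx
    exact ⟨h1, (mem_dXbar_iff g _).mpr ⟨hr, ht⟩⟩
  refine Subgroup.topologicalClosure_minimal _ (sup_le ?_ ?_) ?_
  · rw [Subgroup.commutator_le]
    intro x hx y hy
    obtain ⟨hx1, hxW⟩ := hW hx
    obtain ⟨hy1, hyW⟩ := hW hy
    have hker : (⟨x.2, hxW⟩ * ⟨y.2, hyW⟩ * ⟨x.2, hxW⟩⁻¹ * ⟨y.2, hyW⟩⁻¹ : ↥(dXbar F E g)) ∈ (lamW (F := F) g b).ker := by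
      rw [MonoidHom.mem_ker, map_mul, map_mul, map_mul, map_inv, map_inv, mul_inv_cancel_comm, mul_inv_cancel]
    refine Subgroup.mem_inf.mpr ⟨?_, mem_liftU.mpr ?_⟩
    · change x.1 * y.1 * x.1⁻¹ * y.1⁻¹ = 1
      simp only [hx1, hy1, mul_one, inv_one]
    · change x.2 * y.2 * x.2⁻¹ * y.2⁻¹ ∈ lamKer g b
      exact ⟨_, hker, rfl⟩
  · rw [Subgroup.closure_le]
    rintro _ ⟨y, hy, rfl⟩
    obtain ⟨hy1, hyW⟩ := hW hy
    have hker : (⟨y.2, hyW⟩ ^ l : ↥(dXbar F E g)) ∈ (lamW (F := F) g b).ker := by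
      rw [MonoidHom.mem_ker, map_pow, ← ofAdd_toAdd (lamW g b ⟨y.2, hyW⟩), ← ofAdd_nsmul, nsmul_eq_mul,
        ZMod.natCast_self, zero_mul, ofAdd_zero]
    refine Subgroup.mem_inf.mpr ⟨?_, mem_liftU.mpr ?_⟩
    · change y.1 ^ l = 1
      rw [hy1, one_pow]
    · change y.2 ^ l ∈ lamKer g b
      exact ⟨_, hker, rfl⟩
  · rw [Subgroup.coe_inf]
    exact (pedOf₃ F E Fbar l G g s h a hl ha h5 h6).E.isClosed_geom.inter (isClosed_liftU G _)

/-- **UPPER BOUND for `Ker(Δ_X̲ ↠ Δ_ε)`**: the inertia of every cusp `x ∉ {ε⁰, ε′}` dies under `Λ_h` (`lam_ivec`), so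
`Ker(Δ_X̲ ↠ Δ_ε) ⊆ Δ_C ∩ (G × lamKer_h)` — and so does `I_{ε″}`. [cite: Mochizuki2012, IUTchI §1 p.37] -/
theorem inertia_le_lamKer₃ (hs : ∀ q : Tors E Fbar l ⧸ Subgroup.zpowers g, (QuotientGroup.mk (s q) : _ ⧸ Subgroup.zpowers g) = q)
    (hh : h ^ 2 = a) {q : Tors E Fbar l ⧸ Subgroup.zpowers g} (hq0 : q ≠ 1) (hq1 : q ≠ QuotientGroup.mk a) :
    (pedOf₃ F E Fbar l G g s h a hl ha h5 h6).inertia q ≤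
      (pedOf₃ F E Fbar l G g s h a hl ha h5 h6).DeltaC ⊓ liftU G (lamKer g h) := by
  intro x hx
  obtain ⟨n, rfl⟩ := eq_embU_of_mem_inertia₃ G s h a hl ha h5 h6 hx
  refine Subgroup.mem_inf.mpr ⟨rfl, mem_liftU.mpr (mem_lamKer_iff.mpr ⟨(mem_dXbar_iff g _).mpr ⟨rfl, one_mem _⟩, ?_⟩)⟩
  show lam g h (ivec s h q ^ n) = 1
  rw [map_zpow, lam_ivec s hs hh, if_neg hq0, if_neg hq1, sub_zero, ofAdd_zero, one_zpow]

/-- [cite: Mochizuki2012, IUTchI §1 p.37] -/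
theorem deltaEpsKer_le_lamKer₃ (hs : ∀ q : Tors E Fbar l ⧸ Subgroup.zpowers g, (QuotientGroup.mk (s q) : _ ⧸ Subgroup.zpowers g) = q)
    (hh : h ^ 2 = a) : (pedOf₃ F E Fbar l G g s h a hl ha h5 h6).deltaEpsKer ≤
      (pedOf₃ F E Fbar l G g s h a hl ha h5 h6).DeltaC ⊓ liftU G (lamKer g h) :=
  sup_le (modLKer_le_lamKer₃ G s h a hl ha h5 h6 h)
    (iSup_le fun x => inertia_le_lamKer₃ G s h a hl ha h5 h6 hs hh x.2.1 x.2.2.1)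

/-- **`Λ_h` detects `igen_{ε′}`**: `embU (ivec_{ε′} ^ n) ∈ Δ_C ∩ (G × lamKer_h)` forces `l ∣ n`
(`Λ_h(ivec_{ε′}) = −1`). [cite: Mochizuki2012, IUTchI §1 p.37] -/
theorem cast_eq_zero_of_embU_ivec_ε1_zpow_mem (hs : ∀ q : Tors E Fbar l ⧸ Subgroup.zpowers g, (QuotientGroup.mk (s q) : _ ⧸ Subgroup.zpowers g) = q)
    (hh : h ^ 2 = a) {n : ℤ}
    (hn : embU G (ivec s h (QuotientGroup.mk a) ^ n) ∈
      (pedOf₃ F E Fbar l G g s h a hl ha h5 h6).DeltaC ⊓ liftU G (lamKer g h)) : (n : ZMod l) = 0 := by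
  haveI : Fact l.Prime := ⟨hl⟩
  have habar : (QuotientGroup.mk a : _ ⧸ Subgroup.zpowers g) ≠ 1 := fun h1 => ha ((QuotientGroup.eq_one_iff a).mp h1)
  obtain ⟨-, hlam⟩ := mem_lamKer_iff.mp (mem_liftU.mp (Subgroup.mem_inf.mp hn).2)
  rw [embU_snd, SemidirectProduct.left_inl, SemidirectProduct.left_inl, map_zpow, lam_ivec s hs hh, if_neg habar, if_pos rfl,
    zero_sub, ← ofAdd_zsmul, ofAdd_eq_one, zsmul_eq_mul, mul_neg_one, neg_eq_zero] at hlam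
  exact hlam

end DeltaSide

end TorsionCuspModel

end Literature.IUT.HodgeTheaters

end
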